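import Mathlib
import HarnessLib
import Literature.MathematicalPhysics.QuantumLattice.HubbardGridCounterQuadraticL1
import Summits.HubbardSuperconductivity.HubbardSuperconductivity.Theorems.KLProgrammeKLRegimeEngineScaleZeroE4Geometry
import Summits.HubbardSuperconductivity.HubbardSuperconductivity.Theorems.KLProgrammeKLRegimeEngineScaleZeroNorms

/-!
# K3 engine child (`KLRegimeEngineV14`, stmt-HubbardSuperconductivity-19918), stub `stub_engine_scale0`, clause (E4)₀ `EngineFirstMoments … 0`:
# the decay-WEIGHTED pinned profile of the grid vertex `V_N + 𝒩_{K,N}` (part 1 of the assembly)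

Cell gate-hubbard-kl, seat hubbard-kl-k3c2-p1 (row «scale-0 Gram step `stub_engine_scale0`»).  Clause (E4)₀ of the scale-`0` rung asks, for
every label 4-tuple `Ω` and legs `i, k`,
`ε_x³ · Σ_x spaceTimeDist(x_i, x_k) · ‖klAnisoLegKernel … klE0 0 4 Ω (0, x)‖ ≤ (G.cE4 + Q.cE4|U|)·Klam·|U|`.
As (E1-v4)₀ (`…ScaleZeroNorms`: ONE degree-graded determinant-bounded Gaussian step of the grid vertex `V_N + 𝒩_{K,N}` on the `N = 4M` time grid,
read through the sector analysis map), this file ASSEMBLES the first moment from the DECAY-WEIGHTED BI-GRADED step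
(`GrassmannWeightedEffectiveActionBiGradedMap.sum_wt_norm_kernel_map_effAction_le_biquartic_of_gramBounded`) with the tree weight
`wt = gridLabelWt L (4M) β = 1 + diam` of `…ScaleZeroE4Defs` (positions `gridLegPos` / `latticeLegPos`), leaving THREE weighted sizes as hypotheses:

1. (α_w) the `wt`-pair-weighted row / column sums of the pulled-back scale-`0` covariance `Sᵀ C^K_{>e₀} S` (first space-time moment of the UV
   propagator on the grid — `…ScaleZeroE4Alpha*`, via `HubbardGridCharacters` and the product-torus moment Plancherel);
2. (cr_w / cc_w) the same for the cross-grid overlap kernel `E₀ S` of the scale-`0` multiplier family (`…ScaleZeroE4Overlap*`);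
3. the smallness `θ_w = e·α_w·‖Ṽ‖_{h,wt}/κ² < 1` for the `wt`-weighted pinned profile of the grid vertex, which is EXPLICIT here:
   `N_w(2) = |U||β|/N` (the quartic grid vertex is ultralocal: `wt = 1` on its support, `sum_norm_kernel_hubbardGridInteraction_mul_wt_le`) and
   `N_w(1) = (|β|/N)·Σ_z ‖Ǩ_L(z)‖·(1 + |z|_{ℓ^∞})` (the counterterm is time-local: `sum_norm_kernel_hubbardGridCounterQuadratic_mul_wt_le`; its moment
   is p3's `sum_abs_mul_norm_framePosKernel_le_of_frameOK`, consumed downstream).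

* `sum_norm_kernel_two_structured_mul_wt_le` — weighted pinned sums of the kernel of a structured quadratic polynomial (twin of
  `HubbardGridCounterQuadratic.sum_norm_kernel_two_structured_le` with a permutation-blind weight);
* `gridLabelWt_image_eq_one_of_kernel_hubbardGridInteraction_ne_zero`, `sum_norm_kernel_hubbardGridInteraction_mul_wt_le`,
  `sum_norm_kernel_hubbardGridCounterQuadratic_mul_wt_le`, `sum_norm_kernel_gridVertex_mul_wt_le` (the weighted profile `scaleZeroPinnedW`, written inline);
* the assembly itself (`firstMoment_zero_le_of_wgridStep`) is part 2, `…ScaleZeroE4Assembly`.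

Everything is proved; no definitions, no named facts, no sorry.
-/

noncomputable section

namespace Summit.HubbardSuperconductivity.HubbardSuperconductivity.Theorems.EngineV8

set_option linter.dupNamespace false -- summit = problem name (single-conjunct summit), D-0017

open Real Finset Literature.MathematicalPhysics.QuantumLattice Literature.Probability.LatticeModels
open Literature.Probability.LatticeModels.BattleFederbush
open Literature.MathematicalPhysics.QuantumLattice.GrassmannAlgebra
open Summit.HubbardSuperconductivity.HubbardSuperconductivity.Theorems.KLRegimeSplit
open Summit.HubbardSuperconductivity.HubbardSuperconductivity.Theorems.DispersionFlow
open Summit.HubbardSuperconductivity.HubbardSuperconductivity.Theorems.KLProgrammeLegKernels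

variable {L M : ℕ} [NeZero L]

/-! ## §1 Weighted pinned sums of a structured quadratic polynomial -/

/-- The pinned count of one ordered pair: `Σ_{Y : Y p = w} [Y = v]·g(Y) = [v p = w]·g(v)`. -/
private theorem sum_filter_ite_eq_vec_mul {Γ : Type*} [Fintype Γ] [DecidableEq Γ] (p : Fin 2) (w : Γ) (v : Fin 2 → Γ) (g : (Fin 2 → Γ) → ℝ) :
    ∑ Y ∈ univ.filter (fun Y : Fin 2 → Γ => Y p = w), (if Y = v then (1 : ℝ) else 0) * g Y = if v p = w then g v else 0 := by
  rw [show (fun Y : Fin 2 → Γ => (if Y = v then (1 : ℝ) else 0) * g Y) = fun Y => if Y = v then g v else 0 from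
    funext fun Y => by split_ifs with h <;> simp [h]]
  rw [sum_ite_eq' (univ.filter fun Y : Fin 2 → Γ => Y p = w) v (fun _ => g v)]
  simp only [mem_filter, mem_univ, true_and]

/-- **Weighted pinned `ℓ¹` sums of the `2`-point kernel of a structured quadratic polynomial** `Q = Σ_{i ∈ s} c_i ψ(a_i) ψ(b_i)` against a
nonnegative weight `ω` of the ordered pair with `ω(a_i, b_i), ω(b_i, a_i) ≤ φ_i`: if for every leg `w` the coefficients with `a_i = w`, resp.
`b_i = w`, have `Σ ‖c_i‖ φ_i ≤ B`, then `Σ_{Y : Y p = w} ‖kernel Q 2 Y‖·ω(Y) ≤ B`. -/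
theorem sum_norm_kernel_two_structured_mul_wt_le {Γ : Type*} [Fintype Γ] [DecidableEq Γ] {ι : Type*} (s : Finset ι) (c : ι → ℂ)
    (a b : ι → Γ) (ω : (Fin 2 → Γ) → ℝ) (hω0 : ∀ Y, 0 ≤ ω Y) (φ : ι → ℝ) (hφa : ∀ i ∈ s, ω ![a i, b i] ≤ φ i)
    (hφb : ∀ i ∈ s, ω ![b i, a i] ≤ φ i) {B : ℝ}
    (ha : ∀ w : Γ, ∑ i ∈ s.filter (fun i => a i = w), ‖c i‖ * φ i ≤ B) (hb : ∀ w : Γ, ∑ i ∈ s.filter (fun i => b i = w), ‖c i‖ * φ i ≤ B)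
    (p : Fin 2) (w : Γ) :
    ∑ Y ∈ univ.filter (fun Y : Fin 2 → Γ => Y p = w), ‖kernel ℂ (∑ i ∈ s, c i • (gen ℂ (a i) * gen ℂ (b i))) 2 Y‖ * ω Y ≤ B := by
  have hφ0 : ∀ i ∈ s, 0 ≤ φ i := fun i hi => (hω0 _).trans (hφa i hi)
  have hB : 0 ≤ B := (sum_nonneg fun i hi => mul_nonneg (norm_nonneg (c i)) (hφ0 i (mem_filter.1 hi).1)).trans (ha w)
  -- pointwise: `‖kernel Q 2 Y‖·ω(Y) ≤ Σ_i ‖c_i‖ φ_i · ½([Y = (a_i,b_i)] + [Y = (b_i,a_i)])`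
  have hpt : ∀ Y : Fin 2 → Γ, ‖kernel ℂ (∑ i ∈ s, c i • (gen ℂ (a i) * gen ℂ (b i))) 2 Y‖ * ω Y ≤
      ∑ i ∈ s, ‖c i‖ * φ i * (2⁻¹ * ((if Y = ![a i, b i] then (1 : ℝ) else 0) + (if Y = ![b i, a i] then (1 : ℝ) else 0))) := by
    intro Y
    rw [kernel_sum]
    calc ‖∑ i ∈ s, kernel ℂ (c i • (gen ℂ (a i) * gen ℂ (b i))) 2 Y‖ * ω Y
        ≤ (∑ i ∈ s, ‖c i‖ * (2⁻¹ * ((if Y = ![a i, b i] then (1 : ℝ) else 0) + (if Y = ![b i, a i] then (1 : ℝ) else 0)))) * ω Y := by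
          refine mul_le_mul_of_nonneg_right ((norm_sum_le _ _).trans (sum_le_sum fun i _ => ?_)) (hω0 Y)
          rw [kernel_smul, norm_mul]
          exact mul_le_mul_of_nonneg_left (norm_kernel_two_gen_mul_gen_le (a i) (b i) Y) (norm_nonneg _)
      _ = ∑ i ∈ s, ‖c i‖ * (2⁻¹ * ((if Y = ![a i, b i] then (1 : ℝ) else 0) * ω Y + (if Y = ![b i, a i] then (1 : ℝ) else 0) * ω Y)) := by
          rw [sum_mul]
          exact sum_congr rfl fun i _ => by ring
      _ ≤ ∑ i ∈ s, ‖c i‖ * φ i * (2⁻¹ * ((if Y = ![a i, b i] then (1 : ℝ) else 0) + (if Y = ![b i, a i] then (1 : ℝ) else 0))) := by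
          refine sum_le_sum fun i hi => ?_
          have h1 : (if Y = ![a i, b i] then (1 : ℝ) else 0) * ω Y ≤ (if Y = ![a i, b i] then (1 : ℝ) else 0) * φ i := by
            split_ifs with h
            · rw [h]; simpa using hφa i hi
            · simp
          have h2 : (if Y = ![b i, a i] then (1 : ℝ) else 0) * ω Y ≤ (if Y = ![b i, a i] then (1 : ℝ) else 0) * φ i := by
            split_ifs with h
            · rw [h]; simpa using hφb i hi
            · simp
          nlinarith [norm_nonneg (c i), hφ0 i hi, h1, h2]
  calc ∑ Y ∈ univ.filter (fun Y : Fin 2 → Γ => Y p = w), ‖kernel ℂ (∑ i ∈ s, c i • (gen ℂ (a i) * gen ℂ (b i))) 2 Y‖ * ω Y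
      ≤ ∑ Y ∈ univ.filter (fun Y : Fin 2 → Γ => Y p = w),
          ∑ i ∈ s, ‖c i‖ * φ i * (2⁻¹ * ((if Y = ![a i, b i] then (1 : ℝ) else 0) + (if Y = ![b i, a i] then (1 : ℝ) else 0))) :=
        sum_le_sum fun Y _ => hpt Y
    _ = ∑ i ∈ s, ‖c i‖ * φ i * (2⁻¹ * ((if ![a i, b i] p = w then (1 : ℝ) else 0) + (if ![b i, a i] p = w then (1 : ℝ) else 0))) := by
        rw [sum_comm]
        refine sum_congr rfl fun i _ => ?_
        rw [← mul_sum, ← mul_sum, sum_add_distrib]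
        have h1 := sum_filter_ite_eq_vec_mul p w ![a i, b i] (fun _ => (1 : ℝ))
        have h2 := sum_filter_ite_eq_vec_mul p w ![b i, a i] (fun _ => (1 : ℝ))
        simp only [mul_one] at h1 h2
        rw [h1, h2]
    _ = 2⁻¹ * (∑ i ∈ s.filter (fun i => ![a i, b i] p = w), ‖c i‖ * φ i + ∑ i ∈ s.filter (fun i => ![b i, a i] p = w), ‖c i‖ * φ i) := by
        rw [sum_filter, sum_filter, ← sum_add_distrib, mul_sum]
        refine sum_congr rfl fun i _ => ?_
        split_ifs <;> ring
    _ ≤ 2⁻¹ * (B + B) := by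
        refine mul_le_mul_of_nonneg_left (add_le_add ?_ ?_) (by norm_num)
        · fin_cases p
          · calc ∑ i ∈ s.filter (fun i => ![a i, b i] (⟨0, by norm_num⟩ : Fin 2) = w), ‖c i‖ * φ i
                = ∑ i ∈ s.filter (fun i => a i = w), ‖c i‖ * φ i := by
                  congr 1
              _ ≤ B := ha w
          · calc ∑ i ∈ s.filter (fun i => ![a i, b i] (⟨1, by norm_num⟩ : Fin 2) = w), ‖c i‖ * φ i
                = ∑ i ∈ s.filter (fun i => b i = w), ‖c i‖ * φ i := by
                  congr 1
              _ ≤ B := hb w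
        · fin_cases p
          · calc ∑ i ∈ s.filter (fun i => ![b i, a i] (⟨0, by norm_num⟩ : Fin 2) = w), ‖c i‖ * φ i
                = ∑ i ∈ s.filter (fun i => b i = w), ‖c i‖ * φ i := by
                  congr 1
              _ ≤ B := hb w
          · calc ∑ i ∈ s.filter (fun i => ![b i, a i] (⟨1, by norm_num⟩ : Fin 2) = w), ‖c i‖ * φ i
                = ∑ i ∈ s.filter (fun i => a i = w), ‖c i‖ * φ i := by
                  congr 1
              _ ≤ B := ha w
    _ = B := by ring

/-! ## §2 The weighted pinned profile of the grid vertex `V_N + 𝒩_{K,N}` -/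

section GridVertex

variable {Ng : ℕ} [NeZero Ng]

/-- **The quartic grid vertex is ultralocal**: if `kernel V_N 4 X ≠ 0` then all four legs of `X` sit at one grid point, so the weight of
its position set is `1`. -/
theorem gridLabelWt_image_eq_one_of_kernel_hubbardGridInteraction_ne_zero (β β' U : ℝ) (X : Fin 4 → GridLeg (GridPoint L Ng))
    (hX : kernel ℂ (hubbardGridInteraction L Ng β U) 4 X ≠ 0) :
    gridLabelWt L Ng β' ((univ.image X).image gridLegPos) = 1 := by
  -- some permutation of `X` is the leg string of a grid word
  obtain ⟨p, hp⟩ : ∃ p : GridPoint L Ng, ∀ j, (X j).1.1 = p := by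
    rw [hubbardGridInteraction_eq_presented, kernel_presented] at hX
    have h1 : ∑ σ : Equiv.Perm (Fin 4), Equiv.Perm.sign σ • gridInteractionCoeff L Ng β U (X ∘ σ) ≠ 0 := by
      intro h; exact hX (by rw [h, mul_zero])
    obtain ⟨σ, -, hσ⟩ := exists_ne_zero_of_sum_ne_zero h1
    have h2 : gridInteractionCoeff L Ng β U (X ∘ σ) ≠ 0 := by
      intro h; exact hσ (by rw [h, smul_zero])
    rw [gridInteractionCoeff] at h2
    obtain ⟨p, -, hp⟩ := exists_ne_zero_of_sum_ne_zero h2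
    have h3 : X ∘ σ = gridWordLegs L Ng p := by
      by_contra h; exact hp (if_neg h)
    refine ⟨p, fun j => ?_⟩
    have h4 : X j = (X ∘ σ) (σ.symm j) := by simp
    rw [h4, h3, gridWordLegs_point]
  -- so the position set is a singleton up to repetition, and its diameter vanishes
  rw [gridLabelWt_apply]
  have hdiam : labelDiam (gridLabelDist L Ng β') ((univ.image X).image gridLegPos) ≤ 0 := by
    refine labelDiam_le _ le_rfl fun a ha b hb => ?_
    obtain ⟨Ya, hYa, rfl⟩ := mem_image.1 ha
    obtain ⟨Yb, hYb, rfl⟩ := mem_image.1 hb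
    obtain ⟨ja, -, rfl⟩ := mem_image.1 hYa
    obtain ⟨jb, -, rfl⟩ := mem_image.1 hYb
    rw [gridLegPos_apply, gridLegPos_apply, hp ja, hp jb, gridLabelDist_apply, (isLabelDist_cyclicDist Ng).self]
    simp [torusSiteDist]
  linarith [labelDiam_nonneg (gridLabelDist L Ng β') ((univ.image X).image gridLegPos)]

/-- **Weighted pinned sums of the quartic grid vertex**: `Σ_{X : X q = w} ‖kernel V_N 4 X‖·wt(pos X) ≤ |U|·|β|/N` (the weight is `1` on the
support). -/
theorem sum_norm_kernel_hubbardGridInteraction_mul_wt_le (β β' U : ℝ) (q : Fin 4) (w : GridLeg (GridPoint L Ng)) :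
    ∑ X ∈ univ.filter (fun X : Fin 4 → GridLeg (GridPoint L Ng) => X q = w),
        ‖kernel ℂ (hubbardGridInteraction L Ng β U) 4 X‖ * gridLabelWt L Ng β' ((univ.image X).image gridLegPos) ≤ |U| * |β| / Ng := by
  refine le_trans (sum_le_sum fun X _ => ?_) (sum_norm_kernel_hubbardGridInteraction_le β U q w)
  by_cases hX : kernel ℂ (hubbardGridInteraction L Ng β U) 4 X = 0
  · rw [hX, norm_zero, zero_mul]
  · rw [gridLabelWt_image_eq_one_of_kernel_hubbardGridInteraction_ne_zero β β' U X hX, mul_one]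

omit [NeZero L] [NeZero Ng] in
/-- `torusSiteDist x y = torusSiteDist (x - y) 0` (translation invariance of the periodic distance). -/
theorem torusSiteDist_eq_sub_zero {d : ℕ} (x y : TorusSite d L) : torusSiteDist x y = torusSiteDist (x - y) 0 := by
  simp [torusSiteDist, torusDist]

/-- The pair weight of the two legs of a time-local hopping monomial `ψ⁺_{(j,x⃗)} ψ⁻_{(j,y⃗)}`: `1 + |x⃗ - y⃗|_{ℓ^∞}`. -/
theorem gridLabelWt_pair_sameTime {β' : ℝ} (hβ' : 0 ≤ β') (j : Fin Ng) (x y : TorusSite 2 L) (σ σ' c c' : Fin 2) :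
    gridLabelWt L Ng β' {gridLegPos ((((j, x), σ), c) : GridLeg (GridPoint L Ng)), gridLegPos ((((j, y), σ'), c') : GridLeg (GridPoint L Ng))} =
      1 + torusSiteDist (x - y) 0 := by
  rw [gridLabelWt_pair L Ng hβ', gridLegPos_apply, gridLegPos_apply, gridLabelDist_apply, (isLabelDist_cyclicDist Ng).self, mul_zero, zero_add,
    torusSiteDist_eq_sub_zero]

/-- **Weighted pinned sums of the grid counterterm**: `Σ_{Y : Y p = w} ‖kernel 𝒩_{K,N} 2 Y‖·wt(pos Y) ≤ (|β|/N)·Σ_z ‖Ǩ_L(z)‖·(1 + |z|_{ℓ^∞})`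
(the counterterm is local in time: the pair weight of its two legs is `1 + |x⃗ - y⃗|_{ℓ^∞}`). -/
theorem sum_norm_kernel_hubbardGridCounterQuadratic_mul_wt_le (β : ℝ) {β' : ℝ} (hβ' : 0 ≤ β') (K : TrigPolyC4v) (p : Fin 2)
    (w : GridLeg (GridPoint L Ng)) :
    ∑ Y ∈ univ.filter (fun Y : Fin 2 → GridLeg (GridPoint L Ng) => Y p = w),
        ‖kernel ℂ (hubbardGridCounterQuadratic L Ng β K) 2 Y‖ * gridLabelWt L Ng β' ((univ.image Y).image gridLegPos) ≤
      |β| / Ng * ∑ z : TorusSite 2 L, ‖framePosKernel L K z‖ * (1 + torusSiteDist z 0) := by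
  rw [hubbardGridCounterQuadratic_eq_sum]
  -- the weight of an ordered pair, and the pair weight `1 + |x⃗ - y⃗|` of each monomial
  set ω : (Fin 2 → GridLeg (GridPoint L Ng)) → ℝ := fun Y => gridLabelWt L Ng β' ((univ.image Y).image gridLegPos) with hω
  set φ : Fin 2 × (GridPoint L Ng × TorusSite 2 L) → ℝ := fun i => 1 + torusSiteDist (i.2.1.2 - i.2.2) 0 with hφ
  have hpairset : ∀ u v : GridLeg (GridPoint L Ng), (univ.image ![u, v]).image gridLegPos = {gridLegPos u, gridLegPos v} := by
    intro u v
    rw [image_image]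
    ext z
    simp only [mem_image, mem_univ, true_and, Function.comp_apply, Fin.exists_fin_two, Matrix.cons_val_zero, Matrix.cons_val_one,
      mem_insert, mem_singleton]
    constructor
    · rintro (h | h)
      exacts [Or.inl h.symm, Or.inr h.symm]
    · rintro (h | h)
      exacts [Or.inl h.symm, Or.inr h.symm]
  have hsym : ∀ x y : TorusSite 2 L, torusSiteDist (y - x) 0 = torusSiteDist (x - y) 0 := fun x y => by
    rw [torusSiteDist, torusSiteDist, torusDist, torusDist, sub_zero, sub_zero, ← neg_sub, torusNorm_neg]
  have hφa : ∀ i ∈ (univ : Finset (Fin 2 × (GridPoint L Ng × TorusSite 2 L))),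
      ω ![(((i.2.1, i.1), 0) : GridLeg (GridPoint L Ng)), ((((i.2.1.1, i.2.2), i.1), 1) : GridLeg (GridPoint L Ng))] ≤ φ i := by
    intro i _
    rw [hω]; dsimp only
    rw [hpairset, show i.2.1 = (i.2.1.1, i.2.1.2) from rfl, gridLabelWt_pair_sameTime hβ']
  have hφb : ∀ i ∈ (univ : Finset (Fin 2 × (GridPoint L Ng × TorusSite 2 L))),
      ω ![((((i.2.1.1, i.2.2), i.1), 1) : GridLeg (GridPoint L Ng)), (((i.2.1, i.1), 0) : GridLeg (GridPoint L Ng))] ≤ φ i := by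
    intro i _
    rw [hω]; dsimp only
    rw [hpairset, show i.2.1 = (i.2.1.1, i.2.1.2) from rfl, gridLabelWt_pair_sameTime hβ', hsym]
  refine sum_norm_kernel_two_structured_mul_wt_le univ _ _ _ ω (fun Y => by rw [hω]; exact (zero_le_one.trans (one_le_gridLabelWt _ _ _ _)))
    φ hφa hφb (fun w' => ?_) (fun w' => ?_) p w
  · -- `ψ⁺`-pinned: the sum over `y⃗` of `ε_N ‖Ǩ_L(x⃗_w - y⃗)‖ (1 + |x⃗_w - y⃗|)`
    set s := (univ : Finset (Fin 2 × (GridPoint L Ng × TorusSite 2 L))).filter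
      (fun i => ((((i.2.1, i.1), 0) : GridLeg (GridPoint L Ng))) = w') with hs
    have hmem : ∀ i ∈ s, i.2.1 = w'.1.1 ∧ i.1 = w'.1.2 := by
      intro i hi
      rw [hs, mem_filter] at hi
      have h := hi.2
      exact ⟨by rw [← h], by rw [← h]⟩
    have hinj : Set.InjOn (fun i : Fin 2 × (GridPoint L Ng × TorusSite 2 L) => i.2.2) s := by
      intro i hi i' hi' h
      obtain ⟨h1, h2⟩ := hmem i hi
      obtain ⟨h1', h2'⟩ := hmem i' hi'
      exact Prod.ext (h2.trans h2'.symm) (Prod.ext (h1.trans h1'.symm) h)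
    set g : TorusSite 2 L → ℝ := fun y => |β| / Ng * (‖framePosKernel L K (w'.1.1.2 - y)‖ * (1 + torusSiteDist (w'.1.1.2 - y) 0)) with hg
    have hcongr : ∀ i ∈ s, ‖(((β / Ng : ℝ)) : ℂ) * framePosKernel L K (i.2.1.2 - i.2.2)‖ * φ i = g i.2.2 := by
      intro i hi
      simp only [hg, hφ]
      rw [(hmem i hi).1, norm_mul, Complex.norm_real, Real.norm_eq_abs, abs_div, Nat.abs_cast]
      ring
    have hg0 : ∀ y, 0 ≤ g y := fun y => by rw [hg]; exact mul_nonneg (by positivity) (mul_nonneg (norm_nonneg _) (by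
      have := Nat.cast_nonneg (α := ℝ) (torusDist (Ls := fun _ : Fin 2 => L) (w'.1.1.2 - y) 0); rw [torusSiteDist]; linarith))
    calc ∑ i ∈ s, ‖(((β / Ng : ℝ)) : ℂ) * framePosKernel L K (i.2.1.2 - i.2.2)‖ * φ i = ∑ i ∈ s, g i.2.2 := sum_congr rfl hcongr
      _ = ∑ y ∈ s.image (fun i : Fin 2 × (GridPoint L Ng × TorusSite 2 L) => i.2.2), g y := (sum_image hinj).symm
      _ ≤ ∑ y : TorusSite 2 L, g y := sum_le_sum_of_subset_of_nonneg (subset_univ _) fun y _ _ => hg0 y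
      _ = |β| / Ng * ∑ y : TorusSite 2 L, ‖framePosKernel L K (w'.1.1.2 - y)‖ * (1 + torusSiteDist (w'.1.1.2 - y) 0) := by
          rw [hg, ← mul_sum]
      _ = |β| / Ng * ∑ z : TorusSite 2 L, ‖framePosKernel L K z‖ * (1 + torusSiteDist z 0) := by
          congr 1
          exact Fintype.sum_equiv (Equiv.subLeft w'.1.1.2) _ _ fun y => rfl
  · -- `ψ⁻`-pinned: the sum over `x⃗` of `ε_N ‖Ǩ_L(x⃗ - y⃗_w)‖ (1 + |x⃗ - y⃗_w|)`
    set s := (univ : Finset (Fin 2 × (GridPoint L Ng × TorusSite 2 L))).filter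
      (fun i => (((((i.2.1.1, i.2.2), i.1), 1) : GridLeg (GridPoint L Ng))) = w') with hs
    have hmem : ∀ i ∈ s, i.2.1.1 = w'.1.1.1 ∧ i.2.2 = w'.1.1.2 ∧ i.1 = w'.1.2 := by
      intro i hi
      rw [hs, mem_filter] at hi
      have h := hi.2
      exact ⟨by rw [← h], by rw [← h], by rw [← h]⟩
    have hinj : Set.InjOn (fun i : Fin 2 × (GridPoint L Ng × TorusSite 2 L) => i.2.1.2) s := by
      intro i hi i' hi' h
      obtain ⟨h1, h2, h3⟩ := hmem i hi
      obtain ⟨h1', h2', h3'⟩ := hmem i' hi'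
      exact Prod.ext (h3.trans h3'.symm) (Prod.ext (Prod.ext (h1.trans h1'.symm) h) (h2.trans h2'.symm))
    set g : TorusSite 2 L → ℝ := fun x => |β| / Ng * (‖framePosKernel L K (x - w'.1.1.2)‖ * (1 + torusSiteDist (x - w'.1.1.2) 0)) with hg
    have hcongr : ∀ i ∈ s, ‖(((β / Ng : ℝ)) : ℂ) * framePosKernel L K (i.2.1.2 - i.2.2)‖ * φ i = g i.2.1.2 := by
      intro i hi
      simp only [hg, hφ]
      rw [(hmem i hi).2.1, norm_mul, Complex.norm_real, Real.norm_eq_abs, abs_div, Nat.abs_cast]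
      ring
    have hg0 : ∀ x, 0 ≤ g x := fun x => by rw [hg]; exact mul_nonneg (by positivity) (mul_nonneg (norm_nonneg _) (by
      have := Nat.cast_nonneg (α := ℝ) (torusDist (Ls := fun _ : Fin 2 => L) (x - w'.1.1.2) 0); rw [torusSiteDist]; linarith))
    calc ∑ i ∈ s, ‖(((β / Ng : ℝ)) : ℂ) * framePosKernel L K (i.2.1.2 - i.2.2)‖ * φ i = ∑ i ∈ s, g i.2.1.2 := sum_congr rfl hcongr
      _ = ∑ x ∈ s.image (fun i : Fin 2 × (GridPoint L Ng × TorusSite 2 L) => i.2.1.2), g x := (sum_image hinj).symm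
      _ ≤ ∑ x : TorusSite 2 L, g x := sum_le_sum_of_subset_of_nonneg (subset_univ _) fun x _ _ => hg0 x
      _ = |β| / Ng * ∑ x : TorusSite 2 L, ‖framePosKernel L K (x - w'.1.1.2)‖ * (1 + torusSiteDist (x - w'.1.1.2) 0) := by
          rw [hg, ← mul_sum]
      _ = |β| / Ng * ∑ z : TorusSite 2 L, ‖framePosKernel L K z‖ * (1 + torusSiteDist z 0) := by
          congr 1
          exact Fintype.sum_equiv (Equiv.subRight w'.1.1.2) _ _ fun x => rfl

omit [NeZero Ng] in
/-- The weighted profile of the grid vertex is nonnegative. -/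
theorem scaleZeroPinnedW_nonneg (β U : ℝ) (K : TrigPolyC4v) (m' : ℕ) :
    0 ≤ (if m' = 1 then |β| / Ng * ∑ z : TorusSite 2 L, ‖framePosKernel L K z‖ * (1 + torusSiteDist z 0)
      else if m' = 2 then |U| * |β| / Ng else 0 : ℝ) := by
  have h0 : ∀ z : TorusSite 2 L, 0 ≤ torusSiteDist z 0 := fun z => Nat.cast_nonneg _
  split_ifs
  · exact mul_nonneg (by positivity) (sum_nonneg fun z _ => mul_nonneg (norm_nonneg _) (by linarith [h0 z]))
  · positivity
  · exact le_rfl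

/-- **The weighted pinned profile of the grid vertex** `V_N + 𝒩_{K,N}`: `Σ_{Y : Y j = w} ‖kernel (2m') Y‖·wt(pos Y) ≤ N_w(m')` with
`N_w(1) = (|β|/N)·Σ_z ‖Ǩ_L(z)‖(1 + |z|_{ℓ^∞})`, `N_w(2) = |U||β|/N`, `0` otherwise. -/
theorem sum_norm_kernel_gridVertex_mul_wt_le (β U : ℝ) {β' : ℝ} (hβ' : 0 ≤ β') (K : TrigPolyC4v) (m' : ℕ) (j : Fin (2 * m'))
    (w : GridLeg (GridPoint L Ng)) :
    ∑ Y ∈ univ.filter (fun Y : Fin (2 * m') → GridLeg (GridPoint L Ng) => Y j = w),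
        ‖kernel ℂ (hubbardGridInteraction L Ng β U + hubbardGridCounterQuadratic L Ng β K) (2 * m') Y‖ *
          gridLabelWt L Ng β' ((univ.image Y).image gridLegPos) ≤
      (if m' = 1 then |β| / Ng * ∑ z : TorusSite 2 L, ‖framePosKernel L K z‖ * (1 + torusSiteDist z 0)
        else if m' = 2 then |U| * |β| / Ng else 0 : ℝ) := by
  rcases m' with _ | _ | _ | m'
  · exact absurd j.2 (by omega)
  · -- degree 2: only the counterterm
    have h : ∀ Y : Fin (2 * 1) → GridLeg (GridPoint L Ng),
        kernel ℂ (hubbardGridInteraction L Ng β U + hubbardGridCounterQuadratic L Ng β K) (2 * 1) Y =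
          kernel ℂ (hubbardGridCounterQuadratic L Ng β K) 2 Y := fun Y => by
      rw [kernel_add, kernel_hubbardGridInteraction_of_ne β U (by norm_num) Y, zero_add]
    simp only [h, if_true]
    exact sum_norm_kernel_hubbardGridCounterQuadratic_mul_wt_le β hβ' K j w
  · -- degree 4: only the quartic vertex
    have h : ∀ Y : Fin (2 * 2) → GridLeg (GridPoint L Ng),
        kernel ℂ (hubbardGridInteraction L Ng β U + hubbardGridCounterQuadratic L Ng β K) (2 * 2) Y =
          kernel ℂ (hubbardGridInteraction L Ng β U) 4 Y := fun Y => by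
      rw [kernel_add, kernel_hubbardGridCounterQuadratic_of_ne β K (by norm_num) Y, add_zero]
    simp only [h, show (1 + 1 : ℕ) = 2 from rfl, if_true, show (2 : ℕ) ≠ 1 by norm_num, if_false]
    exact sum_norm_kernel_hubbardGridInteraction_mul_wt_le β β' U j w
  · -- degrees `≥ 6` vanish
    refine le_of_eq_of_le (sum_eq_zero fun Y _ => ?_) (scaleZeroPinnedW_nonneg β U K _)
    rw [kernel_gridVertex_of_two_lt β U K (m' + 3) (by omega) Y, norm_zero, zero_mul]

end GridVertex

end Summit.HubbardSuperconductivity.HubbardSuperconductivity.Theorems.EngineV8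

end
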